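import Literature.NumberTheory.GaloisCohomology.PoitouTateSelmerCountProofs
import HarnessLib

/-!
# The WEAK-LEOPOLDT INEQUALITY at a number field from Poitou–Tate for Selmer structures:
# `∏_{v ∈ S_f} #H¹(K_v, M) ≤ #H¹_{S-rel}(K, M) · #H¹_{S-rel}(K, M^D)`
# (crux ♭T′ stmt-BirchSwinnertonDyer-26975, line `sigmacongruence`, input (1a) of the growth road to stub TS1)

Route `UniversalToricDescent`, lead prover `bsd-wall-utd-p1` g15. THEOREMS ONLY (no definition, no named fact, no
`sorry`); `--supports stmt-BirchSwinnertonDyer-26975`. BSD is not proved by any of this.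

CONTENT. For a family of local invariant maps with `IsPerfect`, `SumLocalTermEqZero`, `SelmerComplement` (ONE such
family is what the route's hypothesis `PoitouTateSelmerStructureDualityFact = ∀ K, poitouTate_selmerStructure_duality K`
asserts), a finite `n`-torsion `M`, `S ⊇ {v ∣ ∞} ∪ {v ∣ n} ∪ Ram(M)` with finite part `S_f`, and Selmer structures
`𝓕 ≤ 𝓖` unramified outside `S`, equal at the infinite places, with `𝓕_v = 0` and `𝓖_v = H¹(K_v, M)` at `v ∈ S_f`, the
tree's COUNTING FORM of Poitou–Tate (`natCard_selmerQuotient_mul_of_poitouTate`) reads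
`#(H¹_𝓖/H¹_𝓕)(K,M) · #(H¹_{𝓕*}/H¹_{𝓖*})(K,M^D) = ∏_{v∈S_f} #H¹(K_v, M)`, whence (`prod_natCard_localH1_le`)

  `∏_{v∈S_f} #H¹(K_v, M) ≤ #H¹_𝓖(K, M) · #H¹_{𝓕*}(K, M^D)`,

and, inv-free (`prod_natCard_localH1_le_of_poitouTate`), `≤ #H¹_𝓖(K, M) · #H¹_{𝓖′}(K, M^D)` for ANY structure `𝓖′` on
`M^D` that is everything on `S` and unramified outside (`𝓕* ≤ 𝓖′` by Milne I Thm. 2.6 = `UnramifiedOrthogonal`).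
With the local Euler characteristic at `v ∣ p` (`#H¹(K_v, M) ≥ #(𝒪_v/#M)`, tree theorem) and `M^D ≅ M` this is the
weak-Leopoldt lower bound `#H¹_{S-rel}(K, M) ≥ #M^{[K:ℚ]/2}` that drives `injective_of_weakLeopoldt_growth`
(p645087) — no `H²`, no naturality.

References: [MilneADT2006] I Thm. 4.10, Thm. 2.8; [Howard2004HeegnerKolyvagin] Thm. 2.1.11; [GreenbergVatsal2000] §2
Prop. (2.1) (where this inequality is obtained from the Euler–Poincaré characteristic over `K_Σ/K_n` instead).
-/

set_option autoImplicit false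
-- the Theorems namespace of this sub repeats the summit name by design (D-0017 nested layout)
set_option linter.dupNamespace false

noncomputable section

open scoped Classical NumberField
open Function NumberField IsDedekindDomain
open Literature.NumberTheory.GaloisCohomology Literature.NumberTheory.GaloisRepresentations
open Literature.NumberTheory.GaloisRepresentations.DiscreteGaloisModule (tateDual SelmerStructure)

universe u

namespace Summit.BirchSwinnertonDyer.BirchSwinnertonDyer.Theorems.UniversalToricDescentWeakLeopoldtCount

variable {K : Type u} [Field K] [NumberField K] {n : ℕ} [NeZero n]
  {M : Type u} [AddCommGroup M] [TopologicalSpace M] [DiscreteTopology M] [Finite M]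

/-- **Weak-Leopoldt inequality, family form.** For a Poitou–Tate family `inv` (`IsPerfect`, `SumLocalTermEqZero`,
`SelmerComplement`), `M` finite `n`-torsion, `S ⊇ {v ∣ ∞} ∪ {v ∣ n} ∪ Ram(M)` with finite part `S_f`, and Selmer
structures `𝓕 ≤ 𝓖` unramified outside `S`, equal at the infinite places, with `𝓕_v = ⊥`, `𝓖_v = ⊤` at every `v ∈ S_f`:
if `H¹_𝓖(K, M)` and `H¹_{𝓕*}(K, M^D)` are finite then `∏_{v∈S_f} #H¹(K_v, M) ≤ #H¹_𝓖(K, M) · #H¹_{𝓕*}(K, M^D)`.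
[cite: MilneADT2006, Ch. I, Thm. 4.10] [cite: Howard2004HeegnerKolyvagin, Thm. 2.1.11 (arXiv:1202.6340 p. 6)] -/
theorem prod_natCard_localH1_le {inv : LocalInvariants K n} (hperf : inv.IsPerfect)
    (hvan : inv.SumLocalTermEqZero) (hcomp : inv.SelmerComplement)
    (ρ : DiscreteGaloisModule K M) (hM : ∀ m : M, n • m = 0) (S : Finset (Place K))
    (hS : ∀ v : HeightOneSpectrum (𝓞 K), (Sum.inr v : Place K) ∉ S →
      ((n : ℕ) : 𝓞 K) ∉ v.asIdeal ∧ GaloisRep.IsUnramifiedAt v ρ)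
    {𝓕 𝓖 : SelmerStructure ρ} (hle : 𝓕 ≤ 𝓖) (h𝓕 : 𝓕.IsUnramifiedOutside S) (h𝓖 : 𝓖.IsUnramifiedOutside S)
    (hinf : ∀ w : InfinitePlace K, 𝓕 (Sum.inl w) = 𝓖 (Sum.inl w))
    (Sf : Finset (HeightOneSpectrum (𝓞 K))) (hSf : ∀ v, v ∈ Sf ↔ (Sum.inr v : Place K) ∈ S)
    (h𝓕bot : ∀ v ∈ Sf, 𝓕 (Sum.inr v) = ⊥) (h𝓖top : ∀ v ∈ Sf, 𝓖 (Sum.inr v) = ⊤)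
    [Finite 𝓖.selmerGroup] [Finite (inv.dualSelmerStructure ρ 𝓕).selmerGroup] :
    ∏ v ∈ Sf, Nat.card (galoisCohomology (ρ.toLocal (Sum.inr v)) 1) ≤
      Nat.card 𝓖.selmerGroup * Nat.card (inv.dualSelmerStructure ρ 𝓕).selmerGroup := by
  have h := natCard_selmerQuotient_mul_of_poitouTate hperf hvan hcomp ρ hM S hS hle h𝓕 h𝓖 hinf Sf hSf
  have hF : ∏ v ∈ Sf, Nat.card (𝓕 (Sum.inr v)) = 1 :=
    Finset.prod_eq_one fun v hv ↦ by rw [h𝓕bot v hv, AddSubgroup.card_bot]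
  have hG : ∏ v ∈ Sf, Nat.card (𝓖 (Sum.inr v)) = ∏ v ∈ Sf, Nat.card (galoisCohomology (ρ.toLocal (Sum.inr v)) 1) :=
    Finset.prod_congr rfl fun v hv ↦ by rw [h𝓖top v hv, AddSubgroup.card_top]
  rw [hF, mul_one, hG] at h
  rw [← h]
  exact Nat.mul_le_mul
    (Nat.card_le_card_of_surjective _ (QuotientAddGroup.mk'_surjective _))
    (Nat.card_le_card_of_surjective _ (QuotientAddGroup.mk'_surjective _))

/-- **Weak-Leopoldt inequality from the named fact, inv-free form.** Under the route's hypothesis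
`poitouTate_selmerStructure_duality K`: for `M` finite `n`-torsion, `S ⊇ {v ∣ ∞} ∪ {v ∣ n} ∪ Ram(M)` with finite part
`S_f`, a Selmer structure `𝓖` on `M` unramified outside `S` with `𝓖_v = ⊤` at every `v ∈ S_f`, and ANY Selmer
structure `𝓖′` on `M^D` unramified outside `S` with `𝓖′_v = ⊤` at every place of `S`: if both Selmer groups are finite,
`∏_{v∈S_f} #H¹(K_v, M) ≤ #H¹_𝓖(K, M) · #H¹_{𝓖′}(K, M^D)`. (The strict partner `𝓕` — `⊥` on `S_f`, `= 𝓖` elsewhere —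
has `𝓕* ≤ 𝓖′` by `UnramifiedOrthogonal`, Milne I Thm. 2.6.) [cite: MilneADT2006, Ch. I, Thm. 4.10, Thm. 2.6]
[cite: Howard2004HeegnerKolyvagin, Thm. 2.1.11 (arXiv:1202.6340 p. 6)] -/
theorem prod_natCard_localH1_le_of_poitouTate (hPT : poitouTate_selmerStructure_duality K)
    (ρ : DiscreteGaloisModule K M) (hM : ∀ m : M, n • m = 0) (S : Finset (Place K))
    (hS : ∀ v : HeightOneSpectrum (𝓞 K), (Sum.inr v : Place K) ∉ S →
      ((n : ℕ) : 𝓞 K) ∉ v.asIdeal ∧ GaloisRep.IsUnramifiedAt v ρ)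
    (Sf : Finset (HeightOneSpectrum (𝓞 K))) (hSf : ∀ v, v ∈ Sf ↔ (Sum.inr v : Place K) ∈ S)
    {𝓖 : SelmerStructure ρ} (h𝓖 : 𝓖.IsUnramifiedOutside S) (h𝓖top : ∀ v ∈ Sf, 𝓖 (Sum.inr v) = ⊤)
    {𝓖' : SelmerStructure (ρ.tateDual n)} (h𝓖' : 𝓖'.IsUnramifiedOutside S) (h𝓖'top : ∀ v ∈ S, 𝓖' v = ⊤)
    [Finite 𝓖.selmerGroup] [Finite 𝓖'.selmerGroup] :
    ∏ v ∈ Sf, Nat.card (galoisCohomology (ρ.toLocal (Sum.inr v)) 1) ≤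
      Nat.card 𝓖.selmerGroup * Nat.card 𝓖'.selmerGroup := by
  obtain ⟨inv, hperf, hvan, hur, hcomp⟩ := hPT n
  -- the strict partner `𝓕`: `⊥` at the finite places of `S`, `𝓖` elsewhere
  let 𝓕 : SelmerStructure ρ := fun v ↦ if (∃ v' ∈ Sf, v = Sum.inr v') then ⊥ else 𝓖 v
  have h𝓕inr_mem : ∀ v ∈ Sf, 𝓕 (Sum.inr v) = ⊥ := fun v hv ↦ if_pos ⟨v, hv, rfl⟩
  have h𝓕inr_nmem : ∀ v ∉ Sf, 𝓕 (Sum.inr v) = 𝓖 (Sum.inr v) := fun v hv ↦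
    if_neg (by rintro ⟨v', hv', h⟩; exact hv ((Sum.inr_injective h).symm ▸ hv'))
  have h𝓕inl : ∀ w : InfinitePlace K, 𝓕 (Sum.inl w) = 𝓖 (Sum.inl w) := fun w ↦
    if_neg (by rintro ⟨v', -, h⟩; exact Sum.inl_ne_inr h)
  have hle : 𝓕 ≤ 𝓖 := by
    intro v
    cases v with
    | inl w => exact (h𝓕inl w).le
    | inr v =>
      by_cases hv : v ∈ Sf
      · rw [h𝓕inr_mem v hv]; exact bot_le
      · exact (h𝓕inr_nmem v hv).le
  have h𝓕S : 𝓕.IsUnramifiedOutside S := by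
    refine ⟨h𝓖.1, fun v hv ↦ ?_⟩
    rw [h𝓕inr_nmem v (fun h ↦ hv ((hSf v).1 h))]
    exact h𝓖.2 v hv
  -- `𝓕* ≤ 𝓖′`
  have hdual : (inv.dualSelmerStructure ρ 𝓕).selmerGroup ≤ 𝓖'.selmerGroup := by
    intro y hy
    rw [SelmerStructure.mem_selmerGroup_iff] at hy ⊢
    intro v
    by_cases hv : v ∈ S
    · rw [h𝓖'top v hv]; exact AddSubgroup.mem_top _
    · cases v with
      | inl w => exact absurd (h𝓖.1 w) hv
      | inr v =>
        have h1 := hy (Sum.inr v)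
        rw [LocalInvariants.dualSelmerStructure_apply, h𝓕inr_nmem v (fun h ↦ hv ((hSf v).1 h)), h𝓖.2 v hv,
          (hur ρ hM v (hS v hv).1 (hS v hv).2).1] at h1
        rwa [h𝓖'.2 v hv]
  haveI : Finite (inv.dualSelmerStructure ρ 𝓕).selmerGroup :=
    Finite.of_injective _ (AddSubgroup.inclusion_injective hdual)
  exact (prod_natCard_localH1_le hperf hvan hcomp ρ hM S hS hle h𝓕S h𝓖 h𝓕inl Sf hSf h𝓕inr_mem h𝓖top).trans
    (Nat.mul_le_mul_left _ (Nat.card_le_card_of_injective _ (AddSubgroup.inclusion_injective hdual)))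

end Summit.BirchSwinnertonDyer.BirchSwinnertonDyer.Theorems.UniversalToricDescentWeakLeopoldtCount

end
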